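import Mathlib

/-!
# Imbrie (2016), the three-spin block: the FREE-ENDS umbilic family (erratum witness)

[cite: ImbrieJSP2016, eq. (1.1), assumption LLA(ν, C)]  Repair cell b2b-imbrie, LLA.md block P
(gen 8), P16(b)/P17(d).  In the three-spin block `H = D + t₁X₁ + t₂X₂ + t₃X₃` of
[ImbrieJSP2016, eq. (1.1)] (landscape `D = c₀ + h₁σ₁ + h₂σ₂ + h₃σ₃ + J₁σ₁σ₂ + J₂σ₂σ₃`, notation of
`FlatPair` / `UmbilicPlanes`) a degenerate pair plane `P` is *fully umbilic* when every one of the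
parameter directions (the bond-1 cells `Π_{(σ₁,σ₂)}`, the bond-2 cells `Π_{(σ₂,σ₃)}`, and
`X₁, X₂, X₃`) compresses to a scalar on `P`; such planes are the exceptional set of the
one-parameter level-repulsion engine.  `UmbilicPlanes` recorded the two families known before
(`Ω`: one σ₂-sector with spins 1 and 3 classical-free, all `t = 0`; `Ξ`: `D = 0`, `t₂ = 0`,
`t₁ = t₃`), and the working census asserted that these exhaust the umbilic set.  THIS IS FALSE, and
this file is the kernel-checked witness: on the codimension-six family
`h₁ = J₁ = 0, h₃ = J₂ = 0, t₁ = t₃ = 0` (both END spins free; the middle spin keeps an arbitrary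
field `h₂σ₂ + t₂X₂`) every level `c₀ ± f`, `f² = h₂² + t₂²`, of `H` is four-fold and contains the
plane spanned by
`Φ₁ = |+,m,+⟩ + |−,m,−⟩`, `Φ₂ = |+,m,−⟩ − |−,m,+⟩` (`m = (p, q)` the dressed state of the middle
spin), on which all cells AND the transverse part compress to scalars (the transverse part to
`4 t₂ p q / (2(p² + q²))`, not to zero).  For `t₂ ≠ 0` the point lies outside both previously
listed families.  (The complete census, LLA.md P17(d), has one codimension-5 component, five of
codimension 6 and one of codimension 7; all are "a free factor ⊗ a degenerate partner on which the
links compress to scalars", so the downstream effective-family analysis is unchanged.)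
Finite identities over the 8 configurations; conventions restated verbatim from `UmbilicPlanes`.
-/

namespace Literature.MathematicalPhysics.QuantumLattice.Imbrie2016

open Finset BigOperators

namespace FreeEndsUmbilic

/-- [cite: ImbrieJSP2016, eq. (1.1)] spin value of a basis index: `0 ↦ +1`, `1 ↦ −1` (as in `FlatPair`). -/
def sgn (a : Fin 2) : ℝ := if a = 0 then 1 else -1

/-- [cite: ImbrieJSP2016, eq. (1.1)] three-spin kets as real functions of the three basis indices (as in `FlatPair`). -/
abbrev Ket := Fin 2 → Fin 2 → Fin 2 → ℝ

/-- [cite: ImbrieJSP2016, eq. (1.1)] the transverse part `t₁X₁ + t₂X₂ + t₃X₃` (as in `FlatPair`). -/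
def transverse (t₁ t₂ t₃ : ℝ) (ψ : Ket) : Ket :=
  fun a b c => t₁ * ψ a.rev b c + t₂ * ψ a b.rev c + t₃ * ψ a b c.rev

/-- [cite: ImbrieJSP2016, eq. (1.1)] the landscape (diagonal part, shift `c₀` adjoined; as in `FlatPair`). -/
def landscape (c₀ h₁ h₂ h₃ J₁ J₂ : ℝ) (a b c : Fin 2) : ℝ :=
  c₀ + h₁ * sgn a + h₂ * sgn b + h₃ * sgn c + J₁ * sgn a * sgn b + J₂ * sgn b * sgn c

/-- [cite: ImbrieJSP2016, eq. (1.1)] real inner product on kets (as in `FlatPair`). -/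
def inner (φ ψ : Ket) : ℝ := ∑ a, ∑ b, ∑ c, φ a b c * ψ a b c

/-- [cite: ImbrieJSP2016, eq. (1.1)] the middle-spin state `m = (p, q)` as a function of the basis
index, written polynomially in `sgn`. -/
noncomputable def mid (p q : ℝ) (b : Fin 2) : ℝ := (1 + sgn b) / 2 * p + (1 - sgn b) / 2 * q

/-- [cite: ImbrieJSP2016, eq. (1.1)] `Φ₁ = |+,m,+⟩ + |−,m,−⟩`, written as `[σ₁ = σ₃]·m(σ₂)`. -/
noncomputable def Φ₁ (p q : ℝ) : Ket := fun a b c => (1 + sgn a * sgn c) / 2 * mid p q b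

/-- [cite: ImbrieJSP2016, eq. (1.1)] `Φ₂ = |+,m,−⟩ − |−,m,+⟩ = J₃Φ₁`, written as `σ₁·[σ₁ ≠ σ₃]·m(σ₂)`. -/
noncomputable def Φ₂ (p q : ℝ) : Ket := fun a b c => sgn a * ((1 - sgn a * sgn c) / 2) * mid p q b

/-- [cite: ImbrieJSP2016, eq. (1.1)] `Φ₁ ⊥ Φ₂`, both of squared norm `2(p² + q²)`. -/
theorem inner_Φ (p q : ℝ) :
    inner (Φ₁ p q) (Φ₂ p q) = 0 ∧ inner (Φ₁ p q) (Φ₁ p q) = 2 * (p ^ 2 + q ^ 2) ∧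
      inner (Φ₂ p q) (Φ₂ p q) = 2 * (p ^ 2 + q ^ 2) := by
  refine ⟨?_, ?_, ?_⟩ <;> norm_num [inner, Φ₁, Φ₂, mid, sgn, Fin.sum_univ_two] <;> ring

/-- [cite: ImbrieJSP2016, eq. (1.1)] TRANSVERSE UMBILICITY of `span{Φ₁, Φ₂}` for ALL `t`: zero cross
terms and the common diagonal value `4 t₂ p q` (so `X₁`, `X₃` compress to `0` and `X₂` to the scalar
`2pq/(p²+q²)`). -/
theorem transverse_compression_Φ (t₁ t₂ t₃ p q : ℝ) :
    inner (Φ₁ p q) (transverse t₁ t₂ t₃ (Φ₁ p q)) = 4 * t₂ * p * q ∧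
      inner (Φ₂ p q) (transverse t₁ t₂ t₃ (Φ₂ p q)) = 4 * t₂ * p * q ∧
      inner (Φ₁ p q) (transverse t₁ t₂ t₃ (Φ₂ p q)) = 0 ∧
      inner (Φ₂ p q) (transverse t₁ t₂ t₃ (Φ₁ p q)) = 0 := by
  refine ⟨?_, ?_, ?_, ?_⟩ <;>
    norm_num [inner, transverse, Φ₁, Φ₂, mid, sgn, Fin.sum_univ_two, Fin.rev] <;> ring

/-- [cite: ImbrieJSP2016, eq. (1.1)] CELL UMBILICITY, bond-1 cells `(σ₁,σ₂) = (r₁,r₂)`: zero cross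
term and equal diagonal values (`= m(r₂)²`) on the pair `Φ₁, Φ₂`. -/
theorem bondOneCell_umbilic_Φ (p q : ℝ) (r₁ r₂ : Fin 2) :
    (∑ c, Φ₁ p q r₁ r₂ c * Φ₂ p q r₁ r₂ c) = 0 ∧
      (∑ c, Φ₁ p q r₁ r₂ c * Φ₁ p q r₁ r₂ c) = (∑ c, Φ₂ p q r₁ r₂ c * Φ₂ p q r₁ r₂ c) := by
  fin_cases r₁ <;> fin_cases r₂ <;> norm_num [Φ₁, Φ₂, mid, sgn, Fin.sum_univ_two]

/-- [cite: ImbrieJSP2016, eq. (1.1)] CELL UMBILICITY, bond-2 cells `(σ₂,σ₃) = (r₂,r₃)`: zero cross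
term and equal diagonal values on the pair `Φ₁, Φ₂`; together with the bond-1 cells this covers the
diagonal directions `σ₃` and `σ₂σ₃` as well. -/
theorem bondTwoCell_umbilic_Φ (p q : ℝ) (r₂ r₃ : Fin 2) :
    (∑ a, Φ₁ p q a r₂ r₃ * Φ₂ p q a r₂ r₃) = 0 ∧
      (∑ a, Φ₁ p q a r₂ r₃ * Φ₁ p q a r₂ r₃) = (∑ a, Φ₂ p q a r₂ r₃ * Φ₂ p q a r₂ r₃) := by
  fin_cases r₂ <;> fin_cases r₃ <;> norm_num [Φ₁, Φ₂, mid, sgn, Fin.sum_univ_two]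

/-- [cite: ImbrieJSP2016, eq. (1.1)] DEGENERATE PARENT at `t₂ ≠ 0`: on the free-ends family
`h₁ = J₁ = h₃ = J₂ = 0`, `t₁ = t₃ = 0`, if `m = (p, q)` is an eigenvector of the middle-spin block
`h₂σ + t₂X` with eigenvalue `f`, then `Φ₁` and `Φ₂` are eigenvectors of
`H = D + t₂X₂` with eigenvalue `c₀ + f`; so the umbilic plane `span{Φ₁, Φ₂}` is an exact degenerate
eigenplane of `H` at a point with a non-zero transverse field — outside both families of
`UmbilicPlanes` (erratum to the census "B = B_cl ∪ B_X" of LLA.md, block P). -/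
theorem eigen_Φ (c₀ h₂ t₂ p q f : ℝ) (hp : h₂ * p + t₂ * q = f * p) (hq : t₂ * p - h₂ * q = f * q) :
    (∀ a b c, landscape c₀ 0 h₂ 0 0 0 a b c * Φ₁ p q a b c + transverse 0 t₂ 0 (Φ₁ p q) a b c =
        (c₀ + f) * Φ₁ p q a b c) ∧
      ∀ a b c, landscape c₀ 0 h₂ 0 0 0 a b c * Φ₂ p q a b c + transverse 0 t₂ 0 (Φ₂ p q) a b c =
        (c₀ + f) * Φ₂ p q a b c := by
  refine ⟨?_, ?_⟩ <;> intro a b c <;> fin_cases a <;> fin_cases b <;> fin_cases c <;>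
    norm_num [landscape, transverse, Φ₁, Φ₂, mid, sgn, Fin.rev] <;> linarith

end FreeEndsUmbilic

end Literature.MathematicalPhysics.QuantumLattice.Imbrie2016
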